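import Summits.HubbardSuperconductivity.HubbardSuperconductivity.Theorems.InfiniteVolumeFirstNoNormalLimitStatePerState
import Literature.MathematicalPhysics.QuantumLattice.InfVolFermionStateDensity
import Literature.MathematicalPhysics.QuantumLattice.InfVolFermionStateHubbardEnergy
import Literature.MathematicalPhysics.QuantumLattice.HubbardEnergyDensityChemicalPotential
import Literature.MathematicalPhysics.QuantumLattice.InfVolFermionStateTorusLimitLocalStability
import HarnessLib

/-!
# `NoNormalLimitState` (crux r2 of `InfiniteVolumeFirst`): torus limits MINIMISE the energy density —
# the Bratteli–Kishimoto–Robinson hypothesis of the per-state reformulation, discharged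

Helper file (`--supports stmt-HubbardSuperconductivity-18533`) for the crux
`Summit.HubbardSuperconductivity.HubbardSuperconductivity.Theses.InfiniteVolumeFirst.NoNormalLimitState`,
line `bkr-minimiser-exclusion` (crux idea card `Cruxes/NoNormalLimitState/Ideas/`).

`InfiniteVolumeFirstNoNormalLimitStatePerState.lean` reduced the crux to two hypotheses,
`noNormalLimitState_of_minimiserExclusion hmin hexcl`:
* `hmin` — every torus-limit state `ω` of an admissible family at `(U, δ)` has density `1 - δ` and
  minimises the Hubbard energy density `e(·) = hubbardEnergyDensity 1 U` among the
  translation-invariant even states of density `1 - δ`;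
* `hexcl` — (for some `δ`, cofinally small `U`) no such minimiser is `d`-wave normal.

This file PROVES `hmin` unconditionally (`stub_torusLimitMinimises`, registered stub of the item),
from the Literature chain landed for it:
`IsTorusLimitOf.density_eq_of_rectN` (the density of a torus limit is the filling),
`IsTorusLimitOf.hubbardEnergyDensity_eq_energyDensity2D` (torus limits of sector ground states
attain Ruelle's thermodynamic energy density `energyDensity2D 1 U (1 - δ)`), and the variational
lower bound `IsTranslationInvariant.energyDensity2D_le_hubbardEnergyDensity` (no
translation-invariant state of density `ρ ∈ (0,2)` lies below `energyDensity2D 1 U ρ`).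
Moreover torus limits minimise the grand-canonical functional `e(ω') - μ ρ(ω')` over ALL
translation-invariant states for some chemical potential `μ` (`exists_chemicalPotential_of_admissible`,
from `HubbardEnergyDensityChemicalPotential`), and are locally stable — Bratteli–Robinson ground states
for every gauge- and `S^z`-invariant local perturbation (`localStability_of_admissible`, from
`InfVolFermionStateTorusLimitLocalStability`). Consequently the crux follows from minimiser exclusion ALONE:
`noNormalLimitState_of_noNormalMinimiser : hexcl → NoNormalLimitState` — the infinite-volume,
purely variational form of the crux ("at weak coupling away from half filling, no
translation-invariant even ground state of the 2D Hubbard mean energy at density `1 - δ` is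
`d`-wave normal"), which is where the open problem (E2 of the census) now sits exactly.
No definition, no named fact, no sorry.
-/

noncomputable section

-- the mandated namespace `Summit.<Summit>.<Problem>.Theorems` repeats `HubbardSuperconductivity`
-- (single-problem summit, D-0017), which the `dupNamespace` linter flags on every declaration
set_option linter.dupNamespace false

namespace Summit.HubbardSuperconductivity.HubbardSuperconductivity.Theorems.NoNormalLimitState

open Literature.MathematicalPhysics.QuantumLattice Literature.Probability.LatticeModels Filter Matrix Finset
open scoped Topology ComplexOrder

/-- **The energy density of a torus-limit state is Ruelle's thermodynamic ground-state energy
density**: under the hypotheses of `stub_torusLimitMinimises`, `e(ω) = energyDensity2D 1 U (1 - δ)`.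
[cite: Ruelle1969, §3.3] -/
theorem hubbardEnergyDensity_eq_of_admissible {δ U : ℝ} {N : ℕ → ℕ} {ψ : ∀ L, Fock (Orb (FermionTorus 2 L))}
    (hδ : δ ∈ Set.Ioo (0:ℝ) (1 / 2)) (hU : 0 < U)
    (hadm : ∀ L, Even L → N L = 2 * ⌊(1 - δ) * (L : ℝ) ^ 2 / 2⌋₊ ∧ star (ψ L) ⬝ᵥ ψ L = 1 ∧
      IsGroundStateInSector (hubbardTorus 2 L 1 U) (N L) 0 (ψ L))
    {Ls : ℕ → ℕ} {ω : InfVolFermionState 2} (hLs : StrictMono Ls) (hev : ∀ j, Even (Ls j))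
    (hlim : ω.IsTorusLimitOf ψ Ls) :
    ω.hubbardEnergyDensity 1 U = ThermodynamicLimit.energyDensity2D 1 U (1 - δ) := by
  have hNeq : ∀ j, N (Ls j) = ThermodynamicLimit.rectN (1 - δ) (Ls j) := fun j => (hadm _ (hev j)).1
  have hgs : ∀ j, IsGroundStateInSector (hubbardTorus 2 (Ls j) 1 U) (ThermodynamicLimit.rectN (1 - δ) (Ls j)) 0
      (ψ (Ls j)) := fun j => by
    rw [← hNeq j]
    exact (hadm _ (hev j)).2.2
  exact hlim.hubbardEnergyDensity_eq_energyDensity2D (t := 1) hLs.tendsto_atTop hU.le (by linarith [hδ.2])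
    (by linarith [hδ.1]) hgs fun j => (hadm _ (hev j)).2.1

/-- **Torus limits minimise the energy density (BKR hypothesis `hmin`, proved).** For every
`δ ∈ (0, 1/2)`, `U > 0` and every admissible family `ψ` (unit `S^z = 0` ground states of
`hubbardTorus 2 L 1 U` in the `2⌊(1-δ)L²/2⌋`-particle sector on the even tori), every torus-limit
state `ω` of `ψ` along a strictly increasing sequence of even sides has particle density `1 - δ`,
and `ω.hubbardEnergyDensity 1 U ≤ ω'.hubbardEnergyDensity 1 U` for every translation-invariant even
state `ω'` of density `1 - δ` (indeed `e(ω) = energyDensity2D 1 U (1 - δ) ≤ e(ω')`).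
[cite: BratteliKishimotoRobinson1978, §3 Thm. 2] [cite: Ruelle1969, §3.4] -/
theorem stub_torusLimitMinimises :
    ∀ (δ U : ℝ) (N : ℕ → ℕ) (ψ : ∀ L, Fock (Orb (FermionTorus 2 L))),
      δ ∈ Set.Ioo (0:ℝ) (1 / 2) → 0 < U →
        (∀ L, Even L → N L = 2 * ⌊(1 - δ) * (L : ℝ) ^ 2 / 2⌋₊ ∧ star (ψ L) ⬝ᵥ ψ L = 1 ∧
            IsGroundStateInSector (hubbardTorus 2 L 1 U) (N L) 0 (ψ L)) →
          ∀ (Ls : ℕ → ℕ) (ω : InfVolFermionState 2), StrictMono Ls → (∀ j, Even (Ls j)) →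
            ω.IsTorusLimitOf ψ Ls →
              ω.density = 1 - δ ∧ ∀ ω' : InfVolFermionState 2, ω'.IsTranslationInvariant →
                ω'.IsEven → ω'.density = 1 - δ →
                  ω.hubbardEnergyDensity 1 U ≤ ω'.hubbardEnergyDensity 1 U := by
  intro δ U N ψ hδ hU hadm Ls ω hLs hev hlim
  have hLs' : Tendsto Ls atTop atTop := hLs.tendsto_atTop
  have hNeq : ∀ j, N (Ls j) = ThermodynamicLimit.rectN (1 - δ) (Ls j) := fun j => (hadm _ (hev j)).1
  have h1 : ∀ j, star (ψ (Ls j)) ⬝ᵥ ψ (Ls j) = 1 := fun j => (hadm _ (hev j)).2.1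
  have hgs : ∀ j, IsGroundStateInSector (hubbardTorus 2 (Ls j) 1 U) (ThermodynamicLimit.rectN (1 - δ) (Ls j)) 0
      (ψ (Ls j)) := fun j => by
    rw [← hNeq j]
    exact (hadm _ (hev j)).2.2
  have hNP : ∀ j, IsNParticle (ThermodynamicLimit.rectN (1 - δ) (Ls j)) (ψ (Ls j)) := fun j =>
    ((mem_szSector_iff _ _ _).1 (hgs j).1).1
  have hn0 : (0 : ℝ) ≤ 1 - δ := by linarith [hδ.2]
  refine ⟨hlim.density_eq_of_rectN hLs' hn0 hNP h1, fun ω' hω' _ hdens' => ?_⟩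
  rw [hubbardEnergyDensity_eq_of_admissible hδ hU hadm hLs hev hlim, ← hdens']
  have hρ0 : 0 < ω'.density := by rw [hdens']; linarith [hδ.2]
  have hρ2 : ω'.density < 2 := by rw [hdens']; linarith [hδ.1]
  exact hω'.energyDensity2D_le_hubbardEnergyDensity 1 hU.le hρ0 hρ2

/-- **Torus limits are grand-canonical minimisers.** Under the hypotheses of
`stub_torusLimitMinimises`, every torus-limit state `ω` of an admissible family minimises the
grand-canonical mean energy `e(ω') - μ ρ(ω')` among ALL translation-invariant states `ω'` of the
lattice fermion system on `ℤ²`, for some chemical potential `μ` (a supporting slope of Ruelle's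
convex energy density at `1 - δ`; `exists_chemicalPotential_of_hubbardEnergyDensity_eq`) — the
canonical torus limits are mean-energy minimisers for the interaction `Φ_{1,U} - μ n` in the
sense of Bratteli–Kishimoto–Robinson. [cite: Ruelle1969, §3.4]
[cite: BratteliKishimotoRobinson1978, §3 Thm. 2] -/
theorem exists_chemicalPotential_of_admissible {δ U : ℝ} {N : ℕ → ℕ} {ψ : ∀ L, Fock (Orb (FermionTorus 2 L))}
    (hδ : δ ∈ Set.Ioo (0:ℝ) (1 / 2)) (hU : 0 < U)
    (hadm : ∀ L, Even L → N L = 2 * ⌊(1 - δ) * (L : ℝ) ^ 2 / 2⌋₊ ∧ star (ψ L) ⬝ᵥ ψ L = 1 ∧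
      IsGroundStateInSector (hubbardTorus 2 L 1 U) (N L) 0 (ψ L))
    {Ls : ℕ → ℕ} {ω : InfVolFermionState 2} (hLs : StrictMono Ls) (hev : ∀ j, Even (Ls j))
    (hlim : ω.IsTorusLimitOf ψ Ls) :
    ∃ μ : ℝ, ∀ ω' : InfVolFermionState 2, ω'.IsTranslationInvariant →
      ω.hubbardEnergyDensity 1 U - μ * ω.density ≤ ω'.hubbardEnergyDensity 1 U - μ * ω'.density := by
  have hdens : ω.density = 1 - δ := (stub_torusLimitMinimises δ U N ψ hδ hU hadm Ls ω hLs hev hlim).1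
  have hρ0 : 0 < ω.density := by rw [hdens]; linarith [hδ.2]
  have hρ2 : ω.density < 2 := by rw [hdens]; linarith [hδ.1]
  refine InfVolFermionState.exists_chemicalPotential_of_hubbardEnergyDensity_eq 1 hU.le hρ0 hρ2 ?_
  rw [hubbardEnergyDensity_eq_of_admissible hδ hU hadm hLs hev hlim, hdens]

/-- **Torus limits are locally stable (gauge-invariant Bratteli–Robinson ground states).** Under the
hypotheses of `stub_torusLimitMinimises`, every torus-limit state `ω` of an admissible family
satisfies the local ground-state inequality `-i ω(Ã⋆ δ(A)) ≥ 0` of Bratteli–Robinson II Def. 5.3.18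
for the Hubbard derivation `δ = i[H_{thicken Λ 1}, ·]` (`hubbardFermionInteraction 2 1 U`) and EVERY
local observable `A ∈ 𝔄_Λ` conserving the local particle number and the local `S^z` — it cannot
lower its energy by any such local perturbation
(`IsTorusLimitOf.neg_I_mul_expect_derivation_nonneg`). [cite: BratteliRobinsonII1997, Prop. 5.3.25] -/
theorem localStability_of_admissible {δ U : ℝ} {N : ℕ → ℕ} {ψ : ∀ L, Fock (Orb (FermionTorus 2 L))}
    (hadm : ∀ L, Even L → N L = 2 * ⌊(1 - δ) * (L : ℝ) ^ 2 / 2⌋₊ ∧ star (ψ L) ⬝ᵥ ψ L = 1 ∧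
      IsGroundStateInSector (hubbardTorus 2 L 1 U) (N L) 0 (ψ L))
    {Ls : ℕ → ℕ} {ω : InfVolFermionState 2} (hLs : StrictMono Ls) (hev : ∀ j, Even (Ls j))
    (hlim : ω.IsTorusLimitOf ψ Ls) {Λ : Finset (Site 2)} {A : FermionOp Λ}
    (hAN : Commute A totalNumber) (hAS : Commute A HubbardWave0.spinZ) :
    0 ≤ -Complex.I * ω.expect (thicken Λ 1)
        ((fermionEmbed (PolySite.incl (subset_thicken Λ 1)) A)ᴴ * (hubbardFermionInteraction 2 1 U).derivation 1 Λ A) :=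
  hlim.neg_I_mul_expect_derivation_nonneg 1 U hLs.tendsto_atTop (N := fun j => N (Ls j)) (M := fun _ => 0)
    (fun j => (hadm _ (hev j)).2.2) hAN hAS

/-- **The crux from minimiser exclusion alone.** If for some `δ ∈ (0, 1/2)` and cofinally small
`U > 0` no translation-invariant even state of density `1 - δ` minimising the Hubbard energy density
`hubbardEnergyDensity 1 U` among such states is `d`-wave normal (its `d`-wave pair correlations have
positive lower box density), then `NoNormalLimitState` holds — `hmin` of
`noNormalLimitState_of_minimiserExclusion` being `stub_torusLimitMinimises`. This is the exact
infinite-volume variational restatement of the crux; the hypothesis is the open weak-coupling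
`d`-wave problem (census E2) in Bratteli–Kishimoto–Robinson form.
[cite: BratteliKishimotoRobinson1978, §3 Thm. 2] -/
theorem noNormalLimitState_of_noNormalMinimiser
    (hexcl : ∃ δ ∈ Set.Ioo (0:ℝ) (1 / 2), ∀ U₀ : ℝ, 0 < U₀ → ∃ U ∈ Set.Ioo (0:ℝ) U₀,
      ∀ ω : InfVolFermionState 2, ω.IsTranslationInvariant → ω.IsEven → ω.density = 1 - δ →
        (∀ ω' : InfVolFermionState 2, ω'.IsTranslationInvariant → ω'.IsEven →
            ω'.density = 1 - δ → ω.hubbardEnergyDensity 1 U ≤ ω'.hubbardEnergyDensity 1 U) →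
          0 < liminf (fun R : ℕ => (∑ x ∈ halfOpenBox 2 R, ∑ y ∈ halfOpenBox 2 R,
            (ω.dWavePairCorr (x - y) 0).re) / ((R : ℕ) : ℝ) ^ 4) atTop) :
    Summit.HubbardSuperconductivity.HubbardSuperconductivity.Theses.InfiniteVolumeFirst.NoNormalLimitState :=
  noNormalLimitState_of_minimiserExclusion stub_torusLimitMinimises hexcl

/-- **The sharpest sufficient condition of this line: no normal infinite-volume ground state.**
`NoNormalLimitState` follows if, for some `δ ∈ (0, 1/2)` and cofinally small `U > 0`, every
translation-invariant even state `ω` on `ℤ²` of density `1 - δ` which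
(i) attains Ruelle's energy density, `e(ω) = energyDensity2D 1 U (1 - δ)` (canonical minimiser),
(ii) minimises `e(ω') - μ ρ(ω')` over all translation-invariant `ω'` for some chemical potential `μ`,
and (iii) is locally stable — `-i ω(Ã⋆ δ(A)) ≥ 0` for every local `A` conserving the local `N` and
`S^z` — has `d`-wave off-diagonal long-range order (positive lower box density of its `d`-wave pair
correlations). All three properties hold for every torus limit of an admissible family
(`hubbardEnergyDensity_eq_of_admissible`, `exists_chemicalPotential_of_admissible`,
`localStability_of_admissible`), so the per-state form of the crux applies. The hypothesis is the
infinite-volume ground-state formulation of the open weak-coupling `d`-wave problem (census E2).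
[cite: BratteliKishimotoRobinson1978, §3 Thm. 2] [cite: BratteliRobinsonII1997, Prop. 5.3.25] -/
theorem noNormalLimitState_of_noNormalGroundState
    (hexcl : ∃ δ ∈ Set.Ioo (0:ℝ) (1 / 2), ∀ U₀ : ℝ, 0 < U₀ → ∃ U ∈ Set.Ioo (0:ℝ) U₀,
      ∀ ω : InfVolFermionState 2, ω.IsTranslationInvariant → ω.IsEven → ω.density = 1 - δ →
        ω.hubbardEnergyDensity 1 U = ThermodynamicLimit.energyDensity2D 1 U (1 - δ) →
        (∃ μ : ℝ, ∀ ω' : InfVolFermionState 2, ω'.IsTranslationInvariant →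
            ω.hubbardEnergyDensity 1 U - μ * ω.density ≤ ω'.hubbardEnergyDensity 1 U - μ * ω'.density) →
        (∀ (Λ : Finset (Site 2)) (A : FermionOp Λ), Commute A totalNumber → Commute A HubbardWave0.spinZ →
            0 ≤ -Complex.I * ω.expect (thicken Λ 1)
              ((fermionEmbed (PolySite.incl (subset_thicken Λ 1)) A)ᴴ *
                (hubbardFermionInteraction 2 1 U).derivation 1 Λ A)) →
          0 < liminf (fun R : ℕ => (∑ x ∈ halfOpenBox 2 R, ∑ y ∈ halfOpenBox 2 R,
            (ω.dWavePairCorr (x - y) 0).re) / ((R : ℕ) : ℝ) ^ 4) atTop) :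
    Summit.HubbardSuperconductivity.HubbardSuperconductivity.Theses.InfiniteVolumeFirst.NoNormalLimitState := by
  obtain ⟨δ, hδ, h⟩ := hexcl
  refine stub_noNormalLimitState_iff_perState.2 ⟨δ, hδ, fun U₀ hU₀ => ?_⟩
  obtain ⟨U, hU, hω⟩ := h U₀ hU₀
  refine ⟨U, hU, fun N ψ hadm Ls ω hLs hev hlim => ?_⟩
  have hN : ∀ j, IsNParticle (N (Ls j)) (ψ (Ls j)) := fun j =>
    ((mem_szSector_iff _ _ _).1 (hadm _ (hev j)).2.2.1).1
  -- evenness needs the particle number only along the sequence: pass to the limit along `Ls`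
  have heven : ω.IsEven := by
    intro Λ A
    refine tendsto_nhds_unique (hlim Λ (parityAut A)) ?_
    have : ∀ j, torusAvgExpect (Ls j) Λ (parityAut A) (ψ (Ls j)) =
        torusAvgExpect (Ls j) Λ A (ψ (Ls j)) := fun j => torusAvgExpect_parityAut _ Λ A (hN j)
    simp_rw [this]
    exact hlim Λ A
  exact hω ω hlim.isTranslationInvariant heven
    (stub_torusLimitMinimises δ U N ψ hδ hU.1 hadm Ls ω hLs hev hlim).1
    (hubbardEnergyDensity_eq_of_admissible hδ hU.1 hadm hLs hev hlim)
    (exists_chemicalPotential_of_admissible hδ hU.1 hadm hLs hev hlim)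
    (fun Λ A hAN hAS => localStability_of_admissible hadm hLs hev hlim hAN hAS)

end Summit.HubbardSuperconductivity.HubbardSuperconductivity.Theorems.NoNormalLimitState

end
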